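import Summits.NavierStokesRegularity.FluidComputer.RowModelIdentity
import HarnessLib

/-!
# The row model, part 4: the per-row soundness theorem (`blocks_on`, `row_sound_on`, `row_sound`)

HONEST FRAMING (cell `pub-fluidc`, blueprint seat bp3, gen 20): low prior, high value-of-information
experiment on Tao's machine paradigm; NOT a claim that NS blows up.

This file is §3 of the text `RowModel` (split only for the 400-line rule; mathematics in the module docstring
of `RowModel.lean`, R1-DESIGN §9): the block induction on `[T₀, min (T₀ + j·2^S h) Ts]` — `closureBlock` on
the (possibly truncated) block with the no-decay chain, in-tree `macroRow` with the decayed chain for a full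
block's end bound, the DERIVED start bound `|e(T₀)| ≤ Ē` (`start_aux_bound`) — and the row theorems:
`row_sound_on` (part `[T₀, Ts]` reached so far), `row_sound` (`Ts = T₁`), `row_end` (the carried `u`),
`row_sd_eq` (the exact phase rate, read-out input).

[cite: Tao2016AveragedNS, §5.5 Thm 5.3 (5.5)]
-/

noncomputable section

namespace Summit.NavierStokesRegularity.FluidComputer

namespace RowModel

open Set Real Filter Topology Matrix
open Literature.Analysis.ODE ImplicitMajorant

variable {ι : Type*} {κ : Type*} [Fintype ι] [Fintype κ] (R : RowModel ι κ) [DecidableEq κ] [DecidableEq ι]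
variable {R}

/-- **Block induction, on the part `[T₀, Ts]` of the row reached so far**: for every `j`, the tube
bounds hold on `[T₀, min (T₀ + j·2^S h) Ts]`, and if the `j`-th block end `T₀ + j·2^S h` is `≤ Ts` then
`|z| ≤ ub j` there. Per block: `closureBlock` on the (possibly truncated) block (no-decay chain, start
`ub j`, strict interior `hsup j`) closes `|e| ≤ Ē`, which makes `hK`, `hf` unconditional for `macroRow`
(decayed chain) on a full block, whose end bound is `≤ ub (j+1)` by `hub j`. The very first
`|e(T₀)| ≤ Ē` is `start_aux_bound`. [folklore] -/
theorem blocks_on (hc : R.Cert) {Ts : ℝ} (hm : R.MemberOn Ts) (hTs0 : R.T₀ ≤ Ts) (hTs : Ts ≤ R.T₁)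
    (hu : ∀ i, |R.z R.T₀ i| ≤ R.ub 0 i) :
    ∀ j : ℕ,
      (∀ t ∈ Icc R.T₀ (min (R.T₀ + (j : ℝ) * R.Hb) Ts),
          (∀ a, |R.e t a| ≤ R.Ebar a) ∧ ∀ i, |R.z t i| ≤ R.Wbar i) ∧
        (R.T₀ + (j : ℝ) * R.Hb ≤ Ts → ∀ i, |R.z (R.T₀ + (j : ℝ) * R.Hb) i| ≤ R.ub j i) := by
  have hHb := Hb_pos hc
  have hT0 : R.T₀ ∈ Icc R.T₀ R.T₁ := left_mem_Icc.2 (T₀_le_T₁ hc)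
  have hT0s : R.T₀ ∈ Icc R.T₀ Ts := left_mem_Icc.2 hTs0
  have hG0 : ∀ a i, 0 ≤ R.Gm a i := fun a i => (abs_nonneg _).trans (hc.hGm R.T₀ hT0 a i)
  have hR0 : ∀ a b, 0 ≤ R.Rm a b := fun a b => (abs_nonneg _).trans (hc.hRm R.T₀ hT0 a b)
  -- `T₀ + j·Hb < T₁` forces `j < nb`
  have hjlt : ∀ j : ℕ, R.T₀ + (j : ℝ) * R.Hb < R.T₁ → j < R.nb := by
    intro j hj
    have h1 : (j : ℝ) * R.Hb < (R.nb : ℝ) * R.Hb := by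
      have := hj; simp only [RowModel.T₁] at this; linarith
    exact_mod_cast lt_of_mul_lt_mul_right h1 hHb.le
  -- a start box below `ub j` lies strictly inside `W̄`
  have hinfl : ∀ j < R.nb, ∀ v : ι → ℝ, (∀ i, 0 ≤ v i) → (∀ i, v i ≤ R.ub j i) →
      ∀ i, v i < R.Wbar i := by
    intro j hj v hv0 hv i
    have hub0 : ∀ k, 0 ≤ R.ub j k := fun k => (hv0 k).trans (hv k)
    have h1 : ∑ k, (if i = k then (1:ℝ) else 0) * R.ub j k ≤ ∑ k, R.An R.S i k * R.ub j k :=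
      Finset.sum_le_sum fun k _ => mul_le_mul_of_nonneg_right (hc.hAnI R.S le_rfl i k) (hub0 k)
    have h2 : ∑ k, (if i = k then (1:ℝ) else 0) * R.ub j k = R.ub j i := by
      simp [ite_mul, Finset.sum_ite_eq, Finset.mem_univ]
    linarith [hc.hbnn R.S le_rfl i, hc.hsup j hj i, hv i]
  have hzW : ∀ i, |R.z R.T₀ i| < R.Wbar i := hinfl 0 hc.hnb _ (fun i => abs_nonneg _) hu
  -- the derived start bound `|e(T₀)| ≤ Ē`
  have he0 : ∀ a, |R.e R.T₀ a| ≤ R.Ebar a := by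
    refine start_aux_bound (x := fun a => |R.e R.T₀ a|) (a := fun a => ∑ i, R.Gm a i * R.Wbar i)
      R.p hR0 ?_ ?_ ?_ hc.hEbar0 hc.hEbar
    · intro b
      exact Finset.sum_nonneg fun i _ => mul_nonneg (hG0 b i) ((abs_nonneg _).trans (hzW i).le)
    · intro b
      refine (rel_e hc hm hTs hT0s b).trans (add_le_add ?_ le_rfl)
      exact Finset.sum_le_sum fun i _ => mul_le_mul_of_nonneg_left (hzW i).le (hG0 b i)
    · show |R.e R.T₀ R.p| = 0
      rw [e_phase hm hT0s, abs_zero]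
  intro j
  induction j with
  | zero =>
    have h0 : R.T₀ + ((0:ℕ) : ℝ) * R.Hb = R.T₀ := by simp
    rw [h0, min_eq_left hTs0]
    refine ⟨fun t ht => ?_, fun _ => hu⟩
    have : t = R.T₀ := le_antisymm ht.2 ht.1
    subst this
    exact ⟨he0, fun i => (hzW i).le⟩
  | succ j ih =>
    obtain ⟨hI, huj⟩ := ih
    set Tj := R.T₀ + (j : ℝ) * R.Hb with hTj_def
    have hTj1 : R.T₀ + ((j + 1 : ℕ) : ℝ) * R.Hb = Tj + 2 ^ R.S * R.h := by
      simp only [hTj_def, RowModel.Hb, Nat.cast_succ]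
      ring
    have hTj0 : R.T₀ ≤ Tj := le_add_of_nonneg_right (mul_nonneg (Nat.cast_nonneg _) hHb.le)
    rw [hTj1]
    rcases le_or_gt Ts Tj with hcase | hcase
    · -- the part reached so far ends before this block starts: nothing new
      rw [min_eq_right hcase] at hI
      refine ⟨fun t ht => hI t ⟨ht.1, ht.2.trans (min_le_right _ _)⟩, fun h => ?_⟩
      exfalso
      have : (0:ℝ) < 2 ^ R.S * R.h := by positivity
      linarith
    · -- block `j`, truncated at `Ts`
      rw [min_eq_left hcase.le] at hI
      have hj : j < R.nb := hjlt j (hcase.trans_le hTs)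
      have huj' : ∀ i, |R.z Tj i| ≤ R.ub j i := huj hcase.le
      set Te := min (Tj + 2 ^ R.S * R.h) Ts with hTe_def
      have hTe1 : Tj ≤ Te := le_min (le_add_of_nonneg_right (by positivity)) hcase.le
      have hTe2 : Te ≤ Tj + 2 ^ R.S * R.h := min_le_left _ _
      have hTe3 : Te ≤ Ts := min_le_right _ _
      have hsubc : Icc Tj Te ⊆ Icc R.T₀ Ts := fun t ht => ⟨hTj0.trans ht.1, ht.2.trans hTe3⟩
      have hsubo : Ico Tj Te ⊆ Ico R.T₀ Ts := fun t ht => ⟨hTj0.trans ht.1, ht.2.trans_le hTe3⟩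
      have heTj : ∀ a, |R.e Tj a| ≤ R.Ebar a := (hI Tj ⟨hTj0, le_rfl⟩).1
      obtain ⟨hzb, heb⟩ := closureBlock (z := R.z) (K := fun s i j => R.Kf s i j) (f := R.f)
        (e := R.e) R.S R.An R.bn R.Wbar R.p R.Gm R.Rm R.Ebar hc.hh hc.hc hTe1 hTe2
        (hzc := fun i => (continuousOn_z hc hm i).mono hsubc)
        (hz := fun s hs i => hasDerivWithinAt_z hc hm (hsubo hs) i)
        (hK := fun s hs hE i j => K_le hc hm hTs (hsubo hs) hE i j)
        (hec := fun a => (continuousOn_e hc hm a).mono hsubc)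
        (herel := fun s hs a => rel_e hc hm hTs (hsubc hs) a) (hG0 := hG0) (hR0 := hR0)
        (hf := fun s hs _ hE i => f_le hc hm hTs (hsubo hs) hE i) (hB0 := hc.hB0)
        (hφ0 := hc.hφ0) (hE0 := hc.hE0) (hE := vec_of_entrywise hc.hIE) (hη' := hc.hη')
        (hA0 := hc.hAn0) (hb0 := hc.hbn0) (hAsq := hc.hAnsq) (hbsq := hc.hbnsq)
        (hAI := hc.hAnI) (hbn := hc.hbnn) (hW := hc.hsup j hj) (hEbar := hc.hEbar)
        (hep := fun s hs => e_phase hm (hsubc hs)) (hEp := hc.hEbar0 R.p) (hu := huj')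
        (he0 := heTj)
      refine ⟨fun t ht => ?_, fun hfull i => ?_⟩
      · rcases le_total t Tj with h | h
        · exact hI t ⟨ht.1, h⟩
        · have htb : t ∈ Icc Tj Te := ⟨h, ht.2⟩
          exact ⟨heb t htb, fun i => ((hzb t htb i).trans_lt (hc.hsup j hj i)).le⟩
      · -- a full block: the decayed chain gives the end bound
        have hTe : Te = Tj + 2 ^ R.S * R.h := min_eq_left hfull
        have hsubc' : Icc Tj (Tj + 2 ^ R.S * R.h) ⊆ Icc R.T₀ Ts := hTe ▸ hsubc
        have hsubo' : Ico Tj (Tj + 2 ^ R.S * R.h) ⊆ Ico R.T₀ Ts := hTe ▸ hsubo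
        have heb' : ∀ s ∈ Icc Tj (Tj + 2 ^ R.S * R.h), ∀ a, |R.e s a| ≤ R.Ebar a := hTe ▸ heb
        have hmac := macroRow (z := R.z) (K := fun s i j => R.Kf s i j) (f := R.f) R.S R.Ad R.bd
          hc.hh hc.hc
          (hzc := fun i => (continuousOn_z hc hm i).mono hsubc')
          (hz := fun s hs i => hasDerivWithinAt_z hc hm (hsubo' hs) i)
          (hK := fun s hs i j =>
            K_le hc hm hTs (hsubo' hs) (heb' s (Ico_subset_Icc_self hs)) i j)
          (hf := fun s hs i => f_le hc hm hTs (hsubo' hs) (heb' s (Ico_subset_Icc_self hs)) i)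
          (hE0 := hc.hE0) (hE := vec_of_entrywise hc.hIE) (hη := hc.hη) (hη' := hc.hη')
          (hA0 := hc.hAd0) (hb0 := hc.hbd0) (hAsq := hc.hAdsq) (hbsq := hc.hbdsq) (hu := huj')
        exact (hmac i).trans (hc.hub j hj i)

/-- **Per-row soundness on the part `[T₀, Ts]` reached so far** (`T₀ ≤ Ts ≤ T₁`; the form the
continuation of the phase map and a row ending at a member's own crossing use). Under the certified tables
(`Cert`) and the member hypotheses on `[T₀, Ts]` (`MemberOn Ts`), from the carried start box
`|z(T₀)| ≤ u = ub 0` alone: `|e| ≤ Ē` and `|z| ≤ W̄` on `[T₀, Ts]`; `|z| ≤ ub j` at every block end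
`T₀ + j·2^S h ≤ Ts`; and `|ṡ − 1| ≤ ρ` on `[T₀, Ts)`. [folklore] -/
theorem row_sound_on (hc : R.Cert) {Ts : ℝ} (hm : R.MemberOn Ts) (hTs0 : R.T₀ ≤ Ts)
    (hTs : Ts ≤ R.T₁) (hu : ∀ i, |R.z R.T₀ i| ≤ R.ub 0 i) :
    (∀ t ∈ Icc R.T₀ Ts, ∀ a, |R.e t a| ≤ R.Ebar a) ∧
    (∀ t ∈ Icc R.T₀ Ts, ∀ i, |R.z t i| ≤ R.Wbar i) ∧
    (∀ j : ℕ, R.T₀ + (j : ℝ) * R.Hb ≤ Ts → ∀ i, |R.z (R.T₀ + (j : ℝ) * R.Hb) i| ≤ R.ub j i) ∧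
    (∀ t ∈ Ico R.T₀ Ts, |R.sd t - 1| ≤ R.ρ) := by
  have hB := blocks_on hc hm hTs0 hTs hu
  have hI : ∀ t ∈ Icc R.T₀ Ts, (∀ a, |R.e t a| ≤ R.Ebar a) ∧ ∀ i, |R.z t i| ≤ R.Wbar i := by
    have h1 := (hB R.nb).1
    have h2 : min (R.T₀ + (R.nb : ℝ) * R.Hb) Ts = Ts := min_eq_right hTs
    rwa [h2] at h1
  exact ⟨fun t ht a => (hI t ht).1 a, fun t ht i => (hI t ht).2 i, fun j hj => (hB j).2 hj,
    fun t ht => (sd_facts hc hm hTs ht (hI t (Ico_subset_Icc_self ht)).1).2.2.2⟩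

/-- **Per-row soundness** (layer A of R1-DESIGN §7.11 (2); the full row `Ts = T₁`). Under the certified
tables (`Cert`) and the member hypotheses (`MemberOn T₁`), from the carried start box `|z(T₀)| ≤ u = ub 0`
alone: on the whole row `|e| ≤ Ē` and `|z| ≤ W̄`; at the block ends `|z(T₀ + j·2^S h)| ≤ ub j`
(`j ≤ nb`; `j = nb` is the end of the row, the next row's `u`); and `|ṡ − 1| ≤ ρ` on `[T₀, T₁)` (input
of the read-out budget). [folklore] -/
theorem row_sound (hc : R.Cert) (hm : R.MemberOn R.T₁) (hu : ∀ i, |R.z R.T₀ i| ≤ R.ub 0 i) :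
    (∀ t ∈ Icc R.T₀ R.T₁, ∀ a, |R.e t a| ≤ R.Ebar a) ∧
    (∀ t ∈ Icc R.T₀ R.T₁, ∀ i, |R.z t i| ≤ R.Wbar i) ∧
    (∀ j ≤ R.nb, ∀ i, |R.z (R.T₀ + (j : ℝ) * R.Hb) i| ≤ R.ub j i) ∧
    (∀ t ∈ Ico R.T₀ R.T₁, |R.sd t - 1| ≤ R.ρ) := by
  obtain ⟨h1, h2, h3, h4⟩ := row_sound_on hc hm (T₀_le_T₁ hc) le_rfl hu
  refine ⟨h1, h2, fun j hj i => h3 j ?_ i, h4⟩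
  have : (j : ℝ) * R.Hb ≤ (R.nb : ℝ) * R.Hb :=
    mul_le_mul_of_nonneg_right (by exact_mod_cast hj) (Hb_pos hc).le
  show R.T₀ + (j : ℝ) * R.Hb ≤ R.T₀ + (R.nb : ℝ) * R.Hb
  linarith

/-- The end-of-row box: `|z(T₁)| ≤ ub nb` (the `u` handed to the next row). [folklore] -/
theorem row_end (hc : R.Cert) (hm : R.MemberOn R.T₁) (hu : ∀ i, |R.z R.T₀ i| ≤ R.ub 0 i) :
    ∀ i, |R.z R.T₁ i| ≤ R.ub R.nb i :=
  ((row_sound hc hm hu).2.2.1) R.nb le_rfl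

/-- Inside the part of the row reached so far, the exact phase rate `ṡ = x̂'_p / (x̂'_p + Ṽ_p)` (input
of the section read-out, R1-DESIGN §7.6, and of the continuation of the phase map). [folklore] -/
theorem row_sd_eq (hc : R.Cert) {Ts : ℝ} (hm : R.MemberOn Ts) (hTs0 : R.T₀ ≤ Ts) (hTs : Ts ≤ R.T₁)
    (hu : ∀ i, |R.z R.T₀ i| ≤ R.ub 0 i) {t : ℝ} (ht : t ∈ Ico R.T₀ Ts) :
    R.sd t = R.xh' t R.p / (R.xh' t R.p + R.Vt t R.p) :=
  (sd_facts hc hm hTs ht ((row_sound_on hc hm hTs0 hTs hu).1 t (Ico_subset_Icc_self ht))).2.2.1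

end RowModel

end Summit.NavierStokesRegularity.FluidComputer
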